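import Mathlib
import HarnessLib
import Summits.MatrixMultiplication.MatrixMultiplication.Theorems.OutsiderSandwichCoupling

/-!
# OutsiderSandwich — normal form of the coupled block `C₁ = T^{[211]}` (decomp-mm lens-4, g17)

Structural census of the g16/g17 objects, made kernel-checked (support for the provable items
`CouplingBenchmark` 28538 and `BlockDiagonal` 28537 of `Theses/OutsiderSandwich.lean`).

The coupled block `C₁ = coupling₁` of `cw₂ ⊗ cw₂` (Coppersmith–Winograd 1990, §7; Landsberg,
*Geometry and Complexity Theory* §3.4.6: "nondisjoint matrix products") is, entrywise,
`C₁ = Σ_{a,b ∈ {1,2}} x_{ab} (y_{a0} z_{0b} + y_{0b} z_{a0})`.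
Decoding `x ↦ (row, col) ∈ Fin 2 × Fin 2` (`mergedTwo`) and `y, z ↦ (half, pos) ∈ Fin 2 × Fin 2`
(`mergedOne`: half `0` = indices `(0, j)`, half `1` = indices `(i, 0)`), this is EXACTLY the tensor
`pairTensor 2` of the bilinear map `(A; u, w) ↦ (A u, Aᵀ w)` for a `2 × 2` matrix `A`
(`u = y_{0·}`, `w = y_{·0}`, `A u = z_{·0}`, `Aᵀ w = z_{0·}`): the `2 × 2` matrix multiplication
`⟨2,2,2⟩ = (A; u, u') ↦ (A u, A u')` with the second matrix–vector product transposed.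

Main statements:
* `coupling₁_apply` — the `0/1` entry formula (`blockOneSupp`);
* `coupling₂_eq_coupling₁`, `coupling₃_eq_coupling₁` — the other two blocks are cyclic rotations;
* `coupling₁_eq_pairTensor`, `pairTensor_restrictsTo_coupling₁`, `coupling₁_restrictsTo_pairTensor`
  — `C₁ ≅ pairTensor 2` (mutual restriction along explicit bijections);
* `coupling₁_eq_zero_of_half_eq` — w.r.t. the halves of the `y`- and `z`-legs the two "diagonal"
  blocks vanish, and `coupling₁_apply_of_halves_zero_one` / `_one_zero` — the two off-diagonal
  blocks are the outer-product tensors `[x = (z, y)]` / `[x = (y, z)]` (`⟨2,1,2⟩` and its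
  transpose).  Consequently the coupling tensor `C = C₁ ⊠ C₂ ⊠ C₃` is a block tensor whose outer
  support is `supp ⟨2,2,2⟩` with blocks `⟨2,1,2⟩ ⊗ ⟨2,2,1⟩ ⊗ ⟨1,2,2⟩ ≅ ⟨4,4,4⟩` — the mechanism
  behind `CouplingBenchmark` (`4 · F⟨2,2,2⟩² ≤ F(C)`, Salem–Spencer on the outer support).
-/

namespace Summit.MatrixMultiplication.MatrixMultiplication.Theorems.OutsiderSandwichBlockNormalForm

open Literature.Computability.AlgebraicComplexity
open Summit.MatrixMultiplication.MatrixMultiplication.Theorems.OutsiderSandwichCoupling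

/-! ## 1. Decoders -/

/-- Row index of `x_a`: `mergedTwo a = (xRow a + 1, xCol a + 1)`. -/
def xRow (a : Fin 4) : Fin 2 := ⟨a.val / 2, by omega⟩

/-- Column index of `x_a`. -/
def xCol (a : Fin 4) : Fin 2 := ⟨a.val % 2, by omega⟩

/-- Half of a weight-one index: `mergedOne b = (0, pos b + 1)` if `half b = 0`,
`= (pos b + 1, 0)` if `half b = 1`. -/
def half (b : Fin 4) : Fin 2 := ⟨b.val / 2, by omega⟩

/-- Position of a weight-one index inside its half. -/
def pos (b : Fin 4) : Fin 2 := ⟨b.val % 2, by omega⟩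

/-- The decoder `Fin 4 ≃ Fin 2 × Fin 2`, `b ↦ (b / 2, b % 2)` (= `(half, pos)` = `(xRow, xCol)`). -/
def decode : Fin 4 ≃ Fin 2 × Fin 2 where
  toFun b := (half b, pos b)
  invFun p := ⟨2 * p.1.val + p.2.val, by omega⟩
  left_inv b := by
    ext; simp only [half, pos]; omega
  right_inv p := by
    rcases p with ⟨⟨i, hi⟩, ⟨j, hj⟩⟩
    simp only [half, pos, Prod.mk.injEq, Fin.mk.injEq]
    omega

/-- `decode b = (half b, pos b)`. -/
theorem decode_apply (b : Fin 4) : decode b = (half b, pos b) := rfl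

/-- The `x`-leg decoder is the same map: `xRow = half`. -/
theorem xRow_eq_half (a : Fin 4) : xRow a = half a := rfl

/-- `xCol = pos`. -/
theorem xCol_eq_pos (a : Fin 4) : xCol a = pos a := rfl

/-! ## 2. The entry formula of `C₁` -/

/-- Support predicate of `C₁`: `x_{(r,c)} ⊗ u_c ⊗ (Au)_r` or `x_{(r,c)} ⊗ w_r ⊗ (Aᵀw)_c`. -/
def blockOneSupp (a b c : Fin 4) : Prop :=
  (half b = 0 ∧ half c = 1 ∧ pos b = xCol a ∧ pos c = xRow a) ∨
    (half b = 1 ∧ half c = 0 ∧ pos b = xRow a ∧ pos c = xCol a)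

/-- `blockOneSupp` is decidable (a finite Boolean combination of `Fin 2` equalities). -/
instance blockOneSupp.decidable (a b c : Fin 4) : Decidable (blockOneSupp a b c) := by
  unfold blockOneSupp; infer_instance

/-- The two `cw₂` support conditions of the factors of `cwSq (mergedTwo a) (mergedOne b) (mergedOne c)`
amount to `blockOneSupp a b c` (finite check). -/
private theorem cw_conditions_iff (a b c : Fin 4) :
    (((mergedTwo a 0 = 0 ∧ mergedOne b 0 = mergedOne c 0 ∧ mergedOne b 0 ≠ 0) ∨
        (mergedOne b 0 = 0 ∧ mergedTwo a 0 = mergedOne c 0 ∧ mergedTwo a 0 ≠ 0) ∨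
        (mergedOne c 0 = 0 ∧ mergedTwo a 0 = mergedOne b 0 ∧ mergedTwo a 0 ≠ 0)) ∧
      ((mergedTwo a 1 = 0 ∧ mergedOne b 1 = mergedOne c 1 ∧ mergedOne b 1 ≠ 0) ∨
        (mergedOne b 1 = 0 ∧ mergedTwo a 1 = mergedOne c 1 ∧ mergedTwo a 1 ≠ 0) ∨
        (mergedOne c 1 = 0 ∧ mergedTwo a 1 = mergedOne b 1 ∧ mergedTwo a 1 ≠ 0))) ↔
      blockOneSupp a b c := by
  revert a b c
  simp only [mergedOne, mergedTwo, blockOneSupp, half, pos, xRow, xCol]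
  decide

/-- **Entry formula**: `C₁(a,b,c) = 1` iff `blockOneSupp a b c`, else `0`. -/
theorem coupling₁_apply (a b c : Fin 4) :
    coupling₁ a b c = if blockOneSupp a b c then 1 else 0 := by
  simp only [coupling₁, kroneckerPow_apply, Fin.prod_univ_two, cwTensor_apply]
  rw [ite_zero_mul_ite_zero, one_mul]
  exact if_congr (cw_conditions_iff a b c) rfl rfl

/-- `cw_q` is invariant under the cyclic rotation of its three indices. -/
theorem cwTensor_rotate (q : ℕ) (i j k : Fin (q + 1)) :
    cwTensor ℂ q i j k = cwTensor ℂ q j k i := by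
  simp only [cwTensor_apply]
  by_cases h₁ : (i = 0 ∧ j = k ∧ j ≠ 0) ∨ (j = 0 ∧ i = k ∧ i ≠ 0) ∨ (k = 0 ∧ i = j ∧ i ≠ 0)
  · have h₂ : (j = 0 ∧ k = i ∧ k ≠ 0) ∨ (k = 0 ∧ j = i ∧ j ≠ 0) ∨ (i = 0 ∧ j = k ∧ j ≠ 0) := by
      rcases h₁ with ⟨h, h', h''⟩ | ⟨h, h', h''⟩ | ⟨h, h', h''⟩
      · exact Or.inr (Or.inr ⟨h, h', h''⟩)
      · exact Or.inl ⟨h, h'.symm, fun hk => h'' (h'.trans hk)⟩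
      · exact Or.inr (Or.inl ⟨h, h'.symm, fun hj => h'' (h'.trans hj)⟩)
    rw [if_pos h₁, if_pos h₂]
  · have h₂ : ¬((j = 0 ∧ k = i ∧ k ≠ 0) ∨ (k = 0 ∧ j = i ∧ j ≠ 0) ∨ (i = 0 ∧ j = k ∧ j ≠ 0)) := by
      rintro (⟨h, h', h''⟩ | ⟨h, h', h''⟩ | ⟨h, h', h''⟩)
      · exact h₁ (Or.inr (Or.inl ⟨h, h'.symm, fun hi => h'' (h'.trans hi)⟩))
      · exact h₁ (Or.inr (Or.inr ⟨h, h'.symm, fun hi => h'' (h'.trans hi)⟩))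
      · exact h₁ (Or.inl ⟨h, h', h''⟩)
    rw [if_neg h₁, if_neg h₂]

/-- `cw₂^{⊗2}` is invariant under the cyclic rotation of its legs. -/
theorem cwSq_rotate (i j k : Fin 2 → Fin 3) : cwSq i j k = cwSq j k i := by
  simp only [kroneckerPow_apply]
  exact Finset.prod_congr rfl fun l _ => cwTensor_rotate 2 _ _ _

/-- `C₂(a,b,c) = C₁(b,c,a)`. -/
theorem coupling₂_eq_coupling₁ (a b c : Fin 4) : coupling₂ a b c = coupling₁ b c a := by
  simp only [coupling₂, coupling₁, cwSq_rotate (mergedOne a)]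

/-- `C₃(a,b,c) = C₁(c,a,b)`. -/
theorem coupling₃_eq_coupling₁ (a b c : Fin 4) : coupling₃ a b c = coupling₁ c a b := by
  simp only [coupling₃, coupling₁, ← cwSq_rotate (mergedTwo c)]

/-! ## 3. `C₁` is the tensor of `(A; u, w) ↦ (A u, Aᵀ w)` -/

/-- **The pair tensor** of the bilinear map `(A; u, w) ↦ (A u, Aᵀ w)` on `n × n` matrices `A`:
legs `A_{(r,c)}`, `(u | w) = (0, ·) | (1, ·)`, `(A u | Aᵀ w) = (1, ·) | (0, ·)`; entry `1` at
`((r,c), (0,c), (1,r))` (the term `A_{rc} u_c` of `(Au)_r`) and at `((r,c), (1,r), (0,c))`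
(the term `A_{rc} w_r` of `(Aᵀw)_c`). -/
def pairTensor (n : ℕ) : Fin n × Fin n → Fin 2 × Fin n → Fin 2 × Fin n → ℂ :=
  fun a y z =>
    if (y.1 = 0 ∧ z.1 = 1 ∧ y.2 = a.2 ∧ z.2 = a.1) ∨ (y.1 = 1 ∧ z.1 = 0 ∧ y.2 = a.1 ∧ z.2 = a.2)
    then 1 else 0

/-- `C₁ = pairTensor 2` along the decoders. -/
theorem coupling₁_eq_pairTensor (a b c : Fin 4) :
    coupling₁ a b c = pairTensor 2 (decode a) (decode b) (decode c) := by
  rw [coupling₁_apply]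
  rfl

/-- `C₁` as the pull-back of `pairTensor 2` along `decode × decode × decode`. -/
theorem coupling₁_eq_pairTensor_comp :
    coupling₁ = fun a b c => pairTensor 2 (decode a) (decode b) (decode c) := by
  funext a b c; exact coupling₁_eq_pairTensor a b c

/-- `pairTensor 2 ≥ C₁`. -/
theorem pairTensor_restrictsTo_coupling₁ : TensorRestrictsTo (pairTensor 2) coupling₁ := by
  rw [coupling₁_eq_pairTensor_comp]
  exact tensorRestrictsTo_precomp _ _ _ _

/-- `C₁ ≥ pairTensor 2` (so `C₁ ≅ pairTensor 2`). -/
theorem coupling₁_restrictsTo_pairTensor : TensorRestrictsTo coupling₁ (pairTensor 2) := by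
  rw [coupling₁_eq_pairTensor_comp]
  exact tensorRestrictsTo_of_reindex _ decode decode decode

/-- Every universal spectral point takes the same value on `C₁` and on `pairTensor 2`. -/
theorem map_coupling₁_eq_map_pairTensor {F : SpectralMap ℂ} (hF : IsUniversalSpectralPoint ℂ F) :
    F coupling₁ = F (pairTensor 2) :=
  le_antisymm (hF.mono _ _ pairTensor_restrictsTo_coupling₁)
    (hF.mono _ _ coupling₁_restrictsTo_pairTensor)

/-! ## 4. The block pattern of `C₁` with respect to the halves -/

/-- The two "diagonal" blocks vanish: no term has `y` and `z` in the same half. -/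
theorem coupling₁_eq_zero_of_half_eq {a b c : Fin 4} (h : half b = half c) : coupling₁ a b c = 0 := by
  rw [coupling₁_apply, if_neg]
  rintro (⟨hb, hc, -, -⟩ | ⟨hb, hc, -, -⟩) <;> rw [hb] at h <;> rw [← h] at hc <;> exact absurd hc (by decide)

/-- Block `(half y, half z) = (0, 1)` (`u`, `Au`): the outer-product tensor `[x = (z, y)]`
(the term `A_{rc} u_c` of `(Au)_r`), i.e. `⟨2,1,2⟩` up to the order of legs. -/
theorem coupling₁_apply_of_halves_zero_one {a b c : Fin 4} (hb : half b = 0) (hc : half c = 1) :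
    coupling₁ a b c = if pos b = xCol a ∧ pos c = xRow a then 1 else 0 := by
  rw [coupling₁_apply]
  refine if_congr ⟨?_, fun h => Or.inl ⟨hb, hc, h.1, h.2⟩⟩ rfl rfl
  rintro (⟨-, -, h₁, h₂⟩ | ⟨hb', -, -, -⟩)
  · exact ⟨h₁, h₂⟩
  · rw [hb] at hb'; exact absurd hb' (by decide)

/-- Block `(half y, half z) = (1, 0)` (`w`, `Aᵀw`): the transposed outer-product tensor
`[x = (y, z)]` (the term `A_{rc} w_r` of `(Aᵀw)_c`). -/
theorem coupling₁_apply_of_halves_one_zero {a b c : Fin 4} (hb : half b = 1) (hc : half c = 0) :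
    coupling₁ a b c = if pos b = xRow a ∧ pos c = xCol a then 1 else 0 := by
  rw [coupling₁_apply]
  refine if_congr ⟨?_, fun h => Or.inr ⟨hb, hc, h.1, h.2⟩⟩ rfl rfl
  rintro (⟨hb', -, -, -⟩ | ⟨-, -, h₁, h₂⟩)
  · rw [hb] at hb'; exact absurd hb' (by decide)
  · exact ⟨h₁, h₂⟩

/-- The support of `C₁` has exactly the eight points of `blockOneSupp` and `C₁` is `0/1`-valued:
restated as the finite census `#{(a,b,c) | blockOneSupp a b c} = 8`. -/
theorem card_blockOneSupp :
    (Finset.univ.filter fun p : Fin 4 × Fin 4 × Fin 4 => blockOneSupp p.1 p.2.1 p.2.2).card = 8 := by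
  simp only [blockOneSupp, half, pos, xRow, xCol]
  decide

/-- TIGHTNESS certificate of `supp C₁` (Strassen 1991; behind `BlockDiagonal`/`BlockSubrankFull`):
with the injective integer weights `α(x_{(r,c)}) = -(r+1) - 3(c+1)`, `β(y) = 3(pos+1)` on half `0`
and `pos+1` on half `1`, `γ(z) = 3(pos+1)` on half `0` and `pos+1` on half `1`, every support point
has weight sum `0`. -/
theorem blockOneSupp_tight (a b c : Fin 4) (h : blockOneSupp a b c) :
    (-((xRow a).val + 1 : ℤ) - 3 * ((xCol a).val + 1)) +
        (if half b = 0 then 3 * ((pos b).val + 1 : ℤ) else ((pos b).val + 1 : ℤ)) +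
        (if half c = 0 then 3 * ((pos c).val + 1 : ℤ) else ((pos c).val + 1 : ℤ)) = 0 := by
  revert a b c
  simp only [blockOneSupp, half, pos, xRow, xCol]
  decide

end Summit.MatrixMultiplication.MatrixMultiplication.Theorems.OutsiderSandwichBlockNormalForm
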